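import Mathlib
import Summits.KontsevichZagierPeriods.Zeta5Search.SecondOrderDigit
import HarnessLib

/-!
# ζ(5) search — THIRD order: the CLASSWISE THIRD-DIGIT LEMMA and THEOREM A⁗ (casLB + 4), statement layer (gen-2 g10)

Cell `pub-zeta5` (HONEST FRAMING: systematic search; no irrationality claim unless certified), ideation seat gen-2, generation 10
(`HOME/pub-zeta5-gen-2/REPORT-gen2-g10.md` §6).  INCREMENT over the tree's `Zeta5Search/SecondOrderDigit.lean` (p231819; §§1–3 there: `phiHat`,
`wHat2`, `vHat2`, `tauW/tauV`, `classTypeList`, `isRaise`, `SecondDigitW/V`, `LawA3`, `SecondOrderCollinearity`) — same namespace, nothing redeclared.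
STATEMENTS ONLY (`@[conjecture] def … : Prop`), all PROVED ON PAPER in REPORT-gen2-g10 §6 (elementary: the exact change of variables `y = −x − pη`
of Theorem B carried to THIRD order, plus the antisymmetrisation identity `P(η) − P(L−η) ∥ (2η − L)` for `deg P ≤ 2`) and exact-checked
(`g10/thirddigit.py`: 318,826 pole classes (W/U rows), 273,137 classes with `E ≤ −3` (V rows), 0 failures; `g10/pairform3.py`, `g10/lawA4.py`:
pair identities and the random / X-ray censuses, 0 failures).  Nothing here bears on irrationality: these are `p`-adic digits of the partial-fraction
data of the Brown–Zudilin rational function `R_b` and the resulting valuation bonus of the contiguity Casoratian.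

Notation as in `SecondOrderDigit`.  NEW class invariants:
* `φ₂,x = phi2Hat := Σ_{s ∉ class} netExp(s)/(s − x)²` (+ centre), `c_x = curvHat := (φ_x² − φ₂,x)/2` (named `curvHat` — `UniversalDigit.cHat` is a
  different, older invariant): the foreign factor to second order, `ĝ_{x+ℓp} ≡ ĝ_x (1 − ℓpφ_x + ℓ²p²c_x) (mod p³)`;
* the functionals of `η²Φ_x` (`ρ[η²Φ]_{ℓ,σ} = ℓ²ρ_{ℓ,σ} + 2ℓρ_{ℓ,σ+1} + ρ_{ℓ,σ+2}`): `ŵ₃ = wHat3`, `v̂₃ = vHat3`;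
* admissible DOUBLE RAISES of a type list (`raiseAtList`, `isRaise2`, Boolean).

## The X-ray zero cells (REPORT §6.6)
The hypotheses of `LawA4` hold, with `M = 10` and the deep type `T = [1,−6,−6,1]`, for `b = n·ray` AND `b + e₇` at every instance `n ≤ 12` of the
sub-ranges `θ = p/n > 25/2` of X1 (69 of the 72 instances of `(12.2, 17]`), `θ > 21/2` of X2 (37 of 46 of `(10,13)`), `θ > 23/2` of X3 (54 of 62 of
`(11,15)`) (`g10/hypscan.py`), hence `v_p(Cas₇) ≥ casLB + 4 = −13` there (exact excess at `n ≤ 9/8/6`: always `≥ 4`).  Below those thresholds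
wrap-around five-point classes of exponent `−8` (lists like `(1,0,−6,−4,1)`) violate the double-raise hypothesis and the τ-line order drops to 1,
but the second-order aggregate itself vanishes there (`r(b) ≡ r(b⁺) ≡ 0 (mod p)` in all 10 computed instances, X2/X3 `n ≤ 8`), so the excess is
still `≥ 4` — by a different mechanism, NOT covered by `LawA4` (open; REPORT §6.6).
-/

open Finset

namespace Summit.KontsevichZagierPeriods.Zeta5Search.SecondOrder

open Summit.KontsevichZagierPeriods.Zeta5Search.ClusterValuation
open Summit.KontsevichZagierPeriods.Zeta5Search.WedgeDictionary (pfData dOf)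
open Summit.KontsevichZagierPeriods.Zeta5Search.CasoratianValuation (InPolytope shift casoratian)
open Summit.KontsevichZagierPeriods.Zeta5Search.RayAtlas (bX1Ray bX2Ray bX3Ray)
open Literature.NumberTheory.Transcendental.BallRivoal (harm)

/-! ## §1 The classwise THIRD-DIGIT lemma (REPORT-gen2-g10 §6.2; PROVED on paper; exact check `g10/thirddigit.py`:
318,826 pole classes for `W`/`U`, 273,137 classes with `E ≤ −3` for `V`, 0 failures)

Write the foreign factor at the base as `Ĝ_x(η) := ĝ_{x+ηp}/ĝ_x ≡ 1 − pφ_x η + p² c_x η²  (mod p³)` (`c_x = (φ_x² − φ₂,x)/2`, Taylor).  Then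
`W_x ≡ (−p)^{E+3} ĝ_x (ŵ − pφ ŵ₂ + p²c ŵ₃)  (mod p^{E+6})` and, for `E ≤ −3`, `V_x ≡ (−p)^E ĝ_x (v̂ − pφ v̂₂ + p²c v̂₃)  (mod p^{E+3})`:
in the `V`-row the two harmonic corrections of the level sums (`N_{k,1} ≡ H_{ℓ} − ℓ' p H^{(2)}_{ℓ}`-type terms and `N_{k,2} ≡ H^{(2)}` terms) CANCEL
each other exactly at this order, and the residue sums `Σρ₁[Φ], Σρ₁[ηΦ], Σρ₁[η²Φ]` vanish because `deg(η²Φ_x) = E + 2 < 0`. -/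

/-- `φ₂,x := Σ_{s ∉ class(x)} netExp(s)/(s − x)²` (+ the odd centre outside the class). -/
def phi2Hat (b : ℕ → ℤ) (p x : ℕ) : ℚ :=
  (∑ s ∈ (range ((b 0).toNat + 1)).filter (fun s => s % p ≠ x % p), (netExp b s : ℚ) / ((s : ℚ) - x) ^ 2)
    + (if ¬ (2 : ℤ) ∣ b 0 ∧ ¬ CentreIn b p x then 1 / ((b 0 : ℚ) / 2 - x) ^ 2 else 0)

/-- `c_x := (φ_x² − φ₂,x)/2`: `ĝ_{x+ℓp} ≡ ĝ_x (1 − ℓpφ_x + ℓ²p² c_x) (mod p³)`. -/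
def curvHat (b : ℕ → ℤ) (p x : ℕ) : ℚ := (phiHat b p x ^ 2 - phi2Hat b p x) / 2

/-- `ŵ₃_x := ŵ[η²Φ_x] = Σ_{poles q} (ℓ_q² ρ_{q,3} + 2ℓ_q ρ_{q,4} + ρ_{q,5})`. -/
noncomputable def wHat3 (b : ℕ → ℤ) (p x : ℕ) : ℚ :=
  ∑ q ∈ classPoles b p x,
    ((if netExp b q ≤ -3 then ((q / p : ℕ) : ℚ) ^ 2 * classRho b p q 3 else 0)
      + (if netExp b q ≤ -4 then 2 * ((q / p : ℕ) : ℚ) * classRho b p q 4 else 0)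
      + (if netExp b q ≤ -5 then classRho b p q 5 else 0))

/-- `v̂₃_x := v̂[η²Φ_x] = Σ_{poles q} Σ_{σ=1}^{n_q} (−1)^σ (ℓ_q² ρ_{q,σ} + 2ℓ_q ρ_{q,σ+1} + ρ_{q,σ+2}) H^{(σ)}_{ℓ_q}`. -/
noncomputable def vHat3 (b : ℕ → ℤ) (p x : ℕ) : ℚ :=
  ∑ q ∈ classPoles b p x, ∑ σ ∈ Icc 1 (-netExp b q).toNat,
    (-1 : ℚ) ^ σ * (((q / p : ℕ) : ℚ) ^ 2 * classRho b p q σ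
        + (if (σ : ℤ) + 1 ≤ -netExp b q then 2 * ((q / p : ℕ) : ℚ) * classRho b p q (σ + 1) else 0)
        + (if (σ : ℤ) + 2 ≤ -netExp b q then classRho b p q (σ + 2) else 0)) * harm σ (q / p)

/-- **(W3) third digit of the `W`-row:** `W_x ≡ (−p)^{E+3} ĝ_x (ŵ_x − pφ_x ŵ₂_x + p²c_x ŵ₃_x)  (mod p^{E+6})`. -/
@[conjecture] def ThirdDigitW : Prop :=
  ∀ (b : ℕ → ℤ) (p x : ℕ), InPolytope b → p.Prime → 5 ≤ p → (b 0 + 2 : ℤ) < (p : ℤ) ^ 2 → x < p → 1 ≤ classPoleCount b p x →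
    (∑ s ∈ classSet b p x, pfData b 2 s)
        - (-(p : ℚ)) ^ (classExp b p x + 3) * gHat b p x
            * (wHat b p x - (p : ℚ) * phiHat b p x * wHat2 b p x + (p : ℚ) ^ 2 * curvHat b p x * wHat3 b p x) ≠ 0 →
      classExp b p x + 6 ≤
        padicValRat p ((∑ s ∈ classSet b p x, pfData b 2 s)
          - (-(p : ℚ)) ^ (classExp b p x + 3) * gHat b p x
            * (wHat b p x - (p : ℚ) * phiHat b p x * wHat2 b p x + (p : ℚ) ^ 2 * curvHat b p x * wHat3 b p x))

/-- **(V3) third digit of `V_x` (`E_x ≤ −3`):** `V_x ≡ (−p)^E ĝ_x (v̂_x − pφ_x v̂₂_x + p²c_x v̂₃_x)  (mod p^{E+3})`. -/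
@[conjecture] def ThirdDigitV : Prop :=
  ∀ (b : ℕ → ℤ) (p x : ℕ), InPolytope b → p.Prime → 5 ≤ p → (b 0 + 2 : ℤ) < (p : ℤ) ^ 2 → x < p → 1 ≤ classPoleCount b p x →
    classExp b p x ≤ -3 →
    classV b p x - (-(p : ℚ)) ^ (classExp b p x) * gHat b p x
        * (vHat b p x - (p : ℚ) * phiHat b p x * vHat2 b p x + (p : ℚ) ^ 2 * curvHat b p x * vHat3 b p x) ≠ 0 →
      classExp b p x + 3 ≤
        padicValRat p (classV b p x - (-(p : ℚ)) ^ (classExp b p x) * gHat b p x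
          * (vHat b p x - (p : ℚ) * phiHat b p x * vHat2 b p x + (p : ℚ) ^ 2 * curvHat b p x * vHat3 b p x))

/-- **Self-conjugate classes have odd exponent** (REPORT §6.1(ii); immediate from the symmetry `netExp(b₀ − q) = netExp(q)` and `InPolytope`:
for `b₀` odd the half-integer centre contributes `+1` and the integer points pair off; for `b₀` even the centre point has exponent `2 − 7`).
Consequently classes of EVEN exponent (`−M`, `−M+2`) are never self-conjugate, and the `¬ CentreIn` clauses below are automatic. -/
@[conjecture] def SelfConjugateOdd : Prop :=
  ∀ (b : ℕ → ℤ) (p x : ℕ), InPolytope b → p.Prime → 5 ≤ p → x < p → 1 ≤ classPoleCount b p x → CentreIn b p x → Odd (classExp b p x)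

/-! ## §2 THEOREM A⁗ — third-order collinearity: one palindromic deep type + single raises + double raises ⇒ FOUR digits (REPORT-gen2-g10 §6; PROVED on paper)

With `Ω_x := W_x/(−p)^{3+m}`, `N_x := V_x/(−p)^m` (`m = −M`) and `τ = τ(T)` the three PAIR IDENTITIES (exact-checked mod `p³`, `g10/pairform3.py`:
deep 806, raise 567 + 126 odd-centre, double-raise 487, end variants 53, all other orbits `≡ 0`: 3,819; 0 failures) read
* deep pair `{x, x̄}` (type `T`, top level `L`):           `(Ω,N)_x + (Ω,N)_x̄ ≡ −p ĝ_x (φ_x − pL c_x) · τ            (mod p³)`,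
* raise pair `{T+δ_k, T+δ_{L−k}}` (exponent `m+1`):         `≡ −p ĝ_y (1 − p(L−k)φ_y) · τ` ; odd-centre class of type `T`: `≡ −p ĝ_y τ/2` (`φ_y ≡ 0`),
* double-raise pair `{T+δ_a+δ_b, T+δ_{L−a}+δ_{L−b}}` (`m+2`): `≡ p² ĝ_z (L − a − b) · τ`  (end-entry variants likewise `∥ τ`),
because the antisymmetrisation `P(η) − P(L−η)` of a polynomial of degree `≤ 2` is a multiple of `2η − L`.  Hence `r(b) := Σ_x (Ω,N)_x / p ≡ a·τ (mod p²)`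
with a `p`-integral scalar `a`; the hit of `e_j` preserves the hypotheses, so `r(b+e_j) ≡ a⁺·τ (mod p²)` and
`Cas_j = p²(−p)^{3+2m} det(r(b), r(b+e_j))` has `v_p ≥ 7 + 2m = casLB + 4`.  Random exact census (`g10/lawA4.py`, seeds 11–14): hypotheses ⇒ excess `≥ 4`
in every instance (excess histogram `{4, 5, 6, 7}`); X-ray cells: §4. -/

/-- `T` with the entry at position `k` increased by one (the `List` form; the function form `raiseAt : (ℕ → ℤ) → ℕ → ℕ → ℤ`
lives in `SecondOrderTypes.lean` — renamed here from the staged `raiseAt` by the filing lane to avoid that name clash, mathematics unchanged). -/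
def raiseAtList (T : List ℤ) (k : ℕ) : List ℤ := T.mapIdx fun i e => if i = k then e + 1 else e

/-- `S` is an ADMISSIBLE DOUBLE RAISE of `T`: two single raises at levels of `T` (the same level allowed), or one raise at a level of `T` plus ONE
new end entry `1`, or one new end entry `2`, or both new end entries `1`. -/
def isRaise2 (T S : List ℤ) : Bool :=
  ((List.range T.length).any fun a => (List.range T.length).any fun c => S == raiseAtList (raiseAtList T a) c) ||
  ((List.range T.length).any fun a => S == 1 :: raiseAtList T a || S == raiseAtList T a ++ [1]) ||
  S == 2 :: T || S == T ++ [2] || S == 1 :: (T ++ [1])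

/-- **THEOREM A⁗ (one-type form, third order).**  Hypotheses of `LawA3` and, in addition, every pole class with `ν = −M+2` has a type list that is an
admissible double raise of `T`.  Then `v_p(Cas_j(b)) ≥ 7 − 2M = casLB + 4` for every admissible direction `j`. -/
@[conjecture] def LawA4 : Prop :=
  ∀ (b : ℕ → ℤ) (p j M : ℕ) (T : List ℤ), InPolytope b → InPolytope (shift b j) → 1 ≤ j → j ≤ 7 → p.Prime → 5 ≤ p → (p : ℤ) ≤ b 0 →
    (b 0 + 2 : ℤ) < (p : ℤ) ^ 2 → 6 ≤ M → Even M → T.reverse = T →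
    (∀ x ∈ multipoleClasses b p, -(M : ℤ) ≤ classExp b p x) →
    (∀ y, y < p → classPoleCount b p y = 1 → -(M : ℤ) + 1 ≤ classNu b p y) →
    (∀ x ∈ multipoleClasses b p, classExp b p x = -(M : ℤ) → ¬ CentreIn b p x ∧ classTypeList b p x = T) →
    (∀ y, y < p → 1 ≤ classPoleCount b p y → classNu b p y = -(M : ℤ) + 1 →
        isRaise T (classTypeList b p y) = true ∨ (¬ (2 : ℤ) ∣ b 0 ∧ CentreIn b p y ∧ classTypeList b p y = T)) →
    (∀ z, z < p → 1 ≤ classPoleCount b p z → classNu b p z = -(M : ℤ) + 2 → isRaise2 T (classTypeList b p z) = true) →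
    casoratian b j ≠ 0 → (7 : ℤ) - 2 * M ≤ padicValRat p (casoratian b j)

end Summit.KontsevichZagierPeriods.Zeta5Search.SecondOrder
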